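import Literature.AlgebraicGeometry.Motives.AbelianVarietyWeilPairingConjugate
import Literature.AlgebraicGeometry.Motives.AbelianVarietyWeilPairingPullback
import Literature.AlgebraicGeometry.Motives.AbelianVarietyWeilPairingRadical
import Literature.AlgebraicGeometry.Motives.AbelianVarietyTorsionPointsCountProofs
import Literature.AlgebraicGeometry.Motives.AbelianVarietyTorsionKerRankProofs
import Literature.AlgebraicGeometry.Motives.AbelianVarietyTorsionCubeProofs
import Literature.AlgebraicGeometry.Motives.AbelianVarietyDegreeGrowth
import Literature.NumberTheory.DiophantineGeometry.AVIsogenyFlat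
import Mathlib.NumberTheory.NumberField.CMField
import HarnessLib

/-!
# Transport of Rosati-balancedness and of the radical bound of the level Weil pairings `ē_N^X`
# under conjugation `X ↦ X^σ` and pullback `X ↦ f^*X`; the radical bound `ℓ^{#K(X)}` for `X` ample
# (Shimura 1998 §17–§18; Mumford §6, §20, §23; Lang VII §2)

Layer `Literature/AlgebraicGeometry/Motives`, namespace `Literature.AlgebraicGeometry.Motives.AbelianVariety`.
KERNEL ONLY: theorems; no definition, no instance, no named fact, no `sorry` (net Literature debt 0).
Cell `hodgecm-mathlib` (D-0151), fan B, row II-1 v2 `shimura1998_thm18_6`, stub S5 `polarisationTransport`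
in Weil-pairing currency (B-p20's PREP-II1-S5, Design W); this file = piece «ROSATI / RADICAL TRANSPORT» cut
by the S5 lead B-p20 (bus 2026-08-28T03:02Z), feeding the hypotheses `hros` / `hrad` of the (G)-step engine
`Literature.NumberTheory.ComplexMultiplication.mul_complexConj_eq_one_of_weilPairingLevel_eq`
(`CMUniformizationWeilPairingRigidity`) for the CONJUGATE structure `(A^σ, ι^σ, X^σ)`.

THE PRINT.  G. Shimura, *Abelian Varieties with Complex Multiplication and Modular Functions* (1998):
§17.2 («`Y^σ` for an algebro-geometric object `Y`», everything rational over the field of definition is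
transported by `σ`); (18.4b) p. 126 («`ι(K)` is stable under the involution of `End_Q(A)` determined by
`𝒞`», i.e. the Rosati involution of the polarisation restricts to complex conjugation `ρ` on `K`);
proof of Thm. 18.6, p. 130–131 (`X^σ`, «`X^σ` corresponds to `ζ′` with respect to both `ξ′`, `ξ″`»).
D. Mumford, *Abelian Varieties* (1970): §20 p. 186, property (3) of `e_n` («`e_n(f(x), ŷ) = e_n(x, f̂(ŷ))`»,
with `φ_{f^*L} = f̂ ∘ φ_L ∘ f`) and §23 p. 208 (the Weil pairing `e^L(x, y) = ē_n(x, φ_L(y))` is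
skew-symmetric and `e^L(γx, y) = e^L(x, γ′y)` for the Rosati involution `γ ↦ γ′`); §6 Application 1
p. 60 (`K(L)` finite for `L` ample).  S. Lang, *Abelian Varieties*, VII §2 Prop. 4 (the radical of `e_n` in the
second variable).

SETTING.  `A` an abelian variety over a field `L`, `X` a Cartier divisor on `A`, `ι : 𝓞_K → End A` for a CM
field `K` with complex conjugation `ρ` (`IsCMField.ringOfIntegersComplexConj K`).  **Rosati-balancedness at
level `N`** (the shape `hros` of the engine): `ē_N^X(ι(a)P, Q) = ē_N^X(P, ι(a^ρ)Q)` for all `a ∈ 𝓞_K`,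
`P, Q ∈ A[N](L)`.  **Radical bound** (the shape `hrad`): `(∀ P, ē_N^X(P, Q) = 1) → Q^m = 1`.

WHAT IS PROVED.
* §1 `weilPairingLevel_rosatiBalanced_conjugate` — Rosati-balancedness of `(A, ι, X)` at level `N` implies that
  of `(A^σ, ι^σ, X^σ)` (`A^σ = A.conjugate σ`, `ι^σ = (A.endConjugate σ).comp ι`, `X^σ = π_σ^* X`), from B-p20's
  `weilPairingLevel_conjugate` «`ē^{X^σ}(P^σ, Q^σ) = σ ē^X(P, Q)`», naturality `(ι(a)P)^σ = ι^σ(a)P^σ`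
  (`conjPoints_map`) and the fact that every `N`-torsion point of `A^σ` is a `P^σ` (`conjPoints` is a group
  isomorphism); `weilPairingLevel_radical_pow_eq_one_conjugate` — the radical bound transports likewise
  (`σ` is injective, `(Q^m)^σ = (Q^σ)^m`);
* §2 `weilPairingLevel_rosatiBalanced_pullback` — Rosati-balancedness of `(B, ι_B, Θ)` implies that of
  `(A, ι_A, f^*Θ)` for a dominant `ι`-EQUIVARIANT homomorphism `f : A → B` (B-p20's `weilPairingLevel_pullback`
  «`ē^{f^*Θ}(P, Q) = ē^Θ(fP, fQ)`», Mumford §20 (3));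
* §3 `weilPairingLevel_radical_pow_card_KTheta` — **the radical bound** for `X` ample over an algebraically
  closed field in which the prime `ℓ` is invertible: if `ē_{ℓᵏ}^X(P, Q) = 1` for all `P ∈ A[ℓᵏ]` then
  `Q ∈ K(X)` (Lang VII §2 Prop. 4, the tree's `weilDiv_linEquiv_zero_of_forall_weilPairingLevel_eq_one`, whose
  Kummer hypotheses on `[ℓᵏ]` — isogeny, flat, `#A[ℓᵏ] = deg [ℓᵏ] = ℓ^{2gk}` — are the tree's theorems
  `isIsogeny_zsmul_id_holds`, `IsIsogeny.flat_toSchemeHom_holds`, `natCard_torsionPoints_eq_of_isAlgClosed`,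
  `kerRank_zsmul_id_holds`), hence `Q^{ℓ^{#K(X)}} = 1` (`pow_prime_pow_natCard_KTheta_eq_one`, `K(X)` finite,
  Mumford §6 App. 1) — the engine's `hrad` with the UNIFORM exponent `c = #K(X)`.

## References
* [Shimura1998] G. Shimura, *Abelian Varieties with Complex Multiplication and Modular Functions* (1998), §17.2,
  (18.4b) p. 126, proof of Thm. 18.6 pp. 130–131.
* [MumfordAV1970] D. Mumford, *Abelian Varieties* (1970), §6 Application 1 (p. 60), §20 (3) (p. 186), §23 (p. 208).
* [Lang1983AbelianVarieties] S. Lang, *Abelian Varieties*, Ch. VII §2 Props. 2–4.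
* [Milne1986AbelianVarieties] J. S. Milne, *Abelian varieties*, in Cornell–Silverman (1986), §16.
-/

universe u

open CategoryTheory CategoryTheory.Limits AlgebraicGeometry

noncomputable section

namespace Literature.AlgebraicGeometry.Motives

open scoped NumberField
open NumberField

namespace AbelianVariety

/-! ## §0 Points under composites -/

section Points

variable {L : Type u} [Field L] {A B C : AbelianVariety L}

/-- `g(f(P)) = (f ≫ g)(P)` on points. [cite: MumfordAV1970, §4] -/
private theorem map_map_hom (f : A ⟶ B) (g : B ⟶ C) (P : A.Points L) :
    AlgPoints.map g.hom.hom.hom (AlgPoints.map f.hom.hom.hom P) = AlgPoints.map (f ≫ g).hom.hom.hom P :=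
  Category.assoc _ _ _

end Points

/-! ## §1 Conjugation `(A, ι, X) ↦ (A^σ, ι^σ, X^σ)` -/

section Conjugate

variable {L : Type u} [Field L] (σ : L ≃+* L) (A : AbelianVariety L)
  (π : (A.conjugate σ).X.left ⟶ A.X.left) (hπ : π = baseChangeHomFst σ.toRingHom A.X) [IsDominant π]
  {N : ℕ}

/-- Every `N`-torsion point of `A^σ` is `P^σ` for an `N`-torsion point `P` of `A` (`x ↦ x^σ` is a group
isomorphism `A(L) ≃ A^σ(L)` preserving the order of points). [cite: Shimura1998, §18.6 Thm. 18.6 (2) p. 127 (the vertical arrow σ)] -/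
theorem exists_coe_eq_conjPoints (Q : (A.conjugate σ).torsionPoints L N) :
    ∃ P : A.torsionPoints L N, (Q : (A.conjugate σ).Points L) = A.conjPoints σ P.1 := by
  obtain ⟨Q, hQ⟩ := Q
  obtain ⟨P, rfl⟩ := (A.conjPoints σ).surjective Q
  exact ⟨⟨P, (A.conjPoints_mem_torsionPoints_iff σ _ P).1 hQ⟩, rfl⟩

variable [IsDominant (Hom.toSchemeHom ((N : ℤ) • 𝟙 A))] [IsDominant (Hom.toSchemeHom ((N : ℤ) • 𝟙 (A.conjugate σ)))]

include hπ in
/-- `ē_N^{X^σ}(P′, Q′) = σ(ē_N^X(P, Q))` for ANY `N`-torsion points `P′, Q′` of `A^σ` whose underlying points are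
`P^σ`, `Q^σ` (B-p20's `weilPairingLevel_conjugate`, freed from the syntactic shape of the membership proofs).
[cite: Shimura1998, §18.6 proof (p. 130)] [cite: Milne1986AbelianVarieties, §16 (p. 131, the pairings ē_m)] -/
theorem weilPairingLevel_conjugate_of_coe_eq (X : CartierDivisor A.X.left) (P Q : A.torsionPoints L N)
    (P' Q' : (A.conjugate σ).torsionPoints L N) (hP : (P' : (A.conjugate σ).Points L) = A.conjPoints σ P.1)
    (hQ : (Q' : (A.conjugate σ).Points L) = A.conjPoints σ Q.1) :
    (A.conjugate σ).weilPairingLevel (X.pullback π) P' Q' = σ (A.weilPairingLevel X P Q) := by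
  obtain ⟨P', hP'⟩ := P'
  obtain ⟨Q', hQ'⟩ := Q'
  change P' = _ at hP
  change Q' = _ at hQ
  subst hP hQ
  exact A.weilPairingLevel_conjugate σ π hπ X P Q

variable {K : Type*} [Field K] [NumberField K] [IsCMField K] (ι : 𝓞 K →+* End A)

include hπ in
/-- **Rosati-balancedness is inherited by the conjugate structure**: if `ē_N^X(ι(a)P, Q) = ē_N^X(P, ι(a^ρ)Q)`
for all `a ∈ 𝓞_K` and `P, Q ∈ A[N](L)`, then `ē_N^{X^σ}(ι^σ(a)P, Q) = ē_N^{X^σ}(P, ι^σ(a^ρ)Q)` for all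
`P, Q ∈ A^σ[N](L)`, where `ι^σ = (A.endConjugate σ).comp ι` and `X^σ = π_σ^* X` — write `P = P₀^σ`,
`Q = Q₀^σ`; both sides are `σ` of the corresponding pairings on `A` (`weilPairingLevel_conjugate`,
`(ι(a)P₀)^σ = ι^σ(a)P₀^σ` by `conjPoints_map`).  Shimura (18.4b): the Rosati involution of the transported
polarisation `𝒞^σ` is again `ρ` on `ι^σ(K)`. [cite: Shimura1998, (18.4b) p. 126 and §18.6 proof p. 130]
[cite: MumfordAV1970, §23 (p. 208), §20 (3) (p. 186)] -/
theorem weilPairingLevel_rosatiBalanced_conjugate (X : CartierDivisor A.X.left)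
    (hros : ∀ (a : 𝓞 K) (P Q : A.torsionPoints L N),
      A.weilPairingLevel X ⟨AlgPoints.map (ι a).hom.hom.hom P.1, map_mem_torsionPoints (ι a) P.2⟩ Q =
        A.weilPairingLevel X P
          ⟨AlgPoints.map (ι (IsCMField.ringOfIntegersComplexConj K a)).hom.hom.hom Q.1,
            map_mem_torsionPoints (ι (IsCMField.ringOfIntegersComplexConj K a)) Q.2⟩)
    (a : 𝓞 K) (P Q : (A.conjugate σ).torsionPoints L N) :
    (A.conjugate σ).weilPairingLevel (X.pullback π)
        ⟨AlgPoints.map ((A.endConjugate σ).comp ι a).hom.hom.hom P.1,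
          map_mem_torsionPoints ((A.endConjugate σ).comp ι a) P.2⟩ Q =
      (A.conjugate σ).weilPairingLevel (X.pullback π) P
        ⟨AlgPoints.map ((A.endConjugate σ).comp ι (IsCMField.ringOfIntegersComplexConj K a)).hom.hom.hom Q.1,
          map_mem_torsionPoints ((A.endConjugate σ).comp ι (IsCMField.ringOfIntegersComplexConj K a)) Q.2⟩ := by
  obtain ⟨P₀, hP₀⟩ := A.exists_coe_eq_conjPoints σ P
  obtain ⟨Q₀, hQ₀⟩ := A.exists_coe_eq_conjPoints σ Q
  -- `(ι^σ(b) R^σ) = (ι(b) R)^σ` on underlying points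
  have key : ∀ (b : 𝓞 K) (R : A.Points L),
      AlgPoints.map ((A.endConjugate σ).comp ι b).hom.hom.hom (A.conjPoints σ R) =
        A.conjPoints σ (AlgPoints.map (ι b).hom.hom.hom R) := fun b R =>
    (A.conjPoints_map σ (ι b) R).symm
  have e1 := A.weilPairingLevel_conjugate_of_coe_eq σ π hπ X
    ⟨AlgPoints.map (ι a).hom.hom.hom P₀.1, map_mem_torsionPoints (ι a) P₀.2⟩ Q₀
    ⟨AlgPoints.map ((A.endConjugate σ).comp ι a).hom.hom.hom P.1,
      map_mem_torsionPoints ((A.endConjugate σ).comp ι a) P.2⟩ Q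
    (by change AlgPoints.map _ P.1 = _; rw [hP₀, key]) hQ₀
  have e2 := A.weilPairingLevel_conjugate_of_coe_eq σ π hπ X P₀
    ⟨AlgPoints.map (ι (IsCMField.ringOfIntegersComplexConj K a)).hom.hom.hom Q₀.1,
      map_mem_torsionPoints (ι (IsCMField.ringOfIntegersComplexConj K a)) Q₀.2⟩ P
    ⟨AlgPoints.map ((A.endConjugate σ).comp ι (IsCMField.ringOfIntegersComplexConj K a)).hom.hom.hom Q.1,
      map_mem_torsionPoints ((A.endConjugate σ).comp ι (IsCMField.ringOfIntegersComplexConj K a)) Q.2⟩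
    hP₀ (by change AlgPoints.map _ Q.1 = _; rw [hQ₀, key])
  rw [e1, e2, hros]

include hπ in
/-- **The radical bound is inherited by the conjugate structure**: if at level `N` every `Q ∈ A[N](L)` with
`ē_N^X(P, Q) = 1` for all `P` satisfies `Q^m = 1`, then the same holds for `X^σ` on `A^σ` — for `Q = Q₀^σ`,
`σ ē^X(P₀, Q₀) = ē^{X^σ}(P₀^σ, Q) = 1` forces `ē^X(P₀, Q₀) = 1`, so `Q₀^m = 1` and `Q^m = (Q₀^m)^σ = 1`.
[cite: Shimura1998, §18.6 proof p. 130] [cite: Lang1983AbelianVarieties, Ch. VII §2 Prop. 4] -/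
theorem weilPairingLevel_radical_pow_eq_one_conjugate (X : CartierDivisor A.X.left) {m : ℕ}
    (hrad : ∀ Q : A.torsionPoints L N,
      (∀ P : A.torsionPoints L N, A.weilPairingLevel X P Q = 1) → (Q : A.Points L) ^ m = 1)
    (Q : (A.conjugate σ).torsionPoints L N)
    (h : ∀ P : (A.conjugate σ).torsionPoints L N, (A.conjugate σ).weilPairingLevel (X.pullback π) P Q = 1) :
    (Q : (A.conjugate σ).Points L) ^ m = 1 := by
  obtain ⟨Q₀, hQ₀⟩ := A.exists_coe_eq_conjPoints σ Q
  have hQ : (Q₀ : A.Points L) ^ m = 1 := by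
    refine hrad Q₀ fun P₀ => σ.injective ?_
    rw [map_one, ← A.weilPairingLevel_conjugate_of_coe_eq σ π hπ X P₀ Q₀
      ⟨A.conjPoints σ P₀.1, A.conjPoints_mem_torsionPoints σ P₀.2⟩ Q rfl hQ₀]
    exact h _
  rw [hQ₀, ← map_pow, hQ, map_one]

end Conjugate

/-! ## §2 Pullback along an `ι`-equivariant homomorphism -/

section Pullback

variable {L : Type u} [Field L] {A B : AbelianVariety L} (f : A ⟶ B) [IsDominant (Hom.toSchemeHom f)]
  {K : Type*} [Field K] [NumberField K] [IsCMField K] (ιA : 𝓞 K →+* End A) (ιB : 𝓞 K →+* End B)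
  {N : ℕ} [IsDominant (Hom.toSchemeHom ((N : ℤ) • 𝟙 A))] [IsDominant (Hom.toSchemeHom ((N : ℤ) • 𝟙 B))]

/-- **Rosati-balancedness is inherited by pullback along a dominant `ι`-equivariant homomorphism**:
if `ē_N^Θ(ι_B(a)P, Q) = ē_N^Θ(P, ι_B(a^ρ)Q)` on `B[N]`, then `ē_N^{f^*Θ}(ι_A(a)P, Q) = ē_N^{f^*Θ}(P, ι_A(a^ρ)Q)`
on `A[N]` for `f : A → B` with `ι_A(a) ≫ f = f ≫ ι_B(a)` — by `ē^{f^*Θ}(P, Q) = ē^Θ(fP, fQ)` (Mumford §20 (3),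
B-p20's `weilPairingLevel_pullback_eq`) and `f(ι_A(a)P) = ι_B(a)f(P)`.  In Shimura's proof this carries the
polar divisor `X` of `(A, 𝒞, ι)` along the `𝔮`-multiplication / the isomorphism `κ`.
[cite: MumfordAV1970, §20 (3) (p. 186), §23 (p. 208)] [cite: Shimura1998, (18.4b) p. 126; §18.6 proof p. 130 (κ⁻¹(X^σ))] -/
theorem weilPairingLevel_rosatiBalanced_pullback (Θ : CartierDivisor B.X.left)
    (hf : ∀ a : 𝓞 K, (ιA a : A ⟶ A) ≫ f = f ≫ (ιB a : B ⟶ B))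
    (hros : ∀ (a : 𝓞 K) (P Q : B.torsionPoints L N),
      B.weilPairingLevel Θ ⟨AlgPoints.map (ιB a).hom.hom.hom P.1, map_mem_torsionPoints (ιB a) P.2⟩ Q =
        B.weilPairingLevel Θ P
          ⟨AlgPoints.map (ιB (IsCMField.ringOfIntegersComplexConj K a)).hom.hom.hom Q.1,
            map_mem_torsionPoints (ιB (IsCMField.ringOfIntegersComplexConj K a)) Q.2⟩)
    (a : 𝓞 K) (P Q : A.torsionPoints L N) :
    A.weilPairingLevel (Θ.pullback (Hom.toSchemeHom f))
        ⟨AlgPoints.map (ιA a).hom.hom.hom P.1, map_mem_torsionPoints (ιA a) P.2⟩ Q =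
      A.weilPairingLevel (Θ.pullback (Hom.toSchemeHom f)) P
        ⟨AlgPoints.map (ιA (IsCMField.ringOfIntegersComplexConj K a)).hom.hom.hom Q.1,
          map_mem_torsionPoints (ιA (IsCMField.ringOfIntegersComplexConj K a)) Q.2⟩ := by
  -- `f(ι_A(b) R) = ι_B(b) f(R)` on underlying points
  have key : ∀ (b : 𝓞 K) (R : A.Points L),
      AlgPoints.map f.hom.hom.hom (AlgPoints.map (ιA b).hom.hom.hom R) =
        AlgPoints.map (ιB b).hom.hom.hom (AlgPoints.map f.hom.hom.hom R) := fun b R => by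
    rw [map_map_hom, map_map_hom]
    exact congrArg (fun g : A ⟶ B => AlgPoints.map g.hom.hom.hom R) (hf b)
  have e1 := weilPairingLevel_pullback_eq f Θ
    ⟨AlgPoints.map (ιA a).hom.hom.hom P.1, map_mem_torsionPoints (ιA a) P.2⟩ Q
    ⟨AlgPoints.map (ιB a).hom.hom.hom (AlgPoints.map f.hom.hom.hom P.1),
      map_mem_torsionPoints (ιB a) (map_mem_torsionPoints f P.2)⟩
    ⟨AlgPoints.map f.hom.hom.hom Q.1, map_mem_torsionPoints f Q.2⟩ (key a P.1).symm rfl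
  have e2 := weilPairingLevel_pullback_eq f Θ P
    ⟨AlgPoints.map (ιA (IsCMField.ringOfIntegersComplexConj K a)).hom.hom.hom Q.1,
      map_mem_torsionPoints (ιA (IsCMField.ringOfIntegersComplexConj K a)) Q.2⟩
    ⟨AlgPoints.map f.hom.hom.hom P.1, map_mem_torsionPoints f P.2⟩
    ⟨AlgPoints.map (ιB (IsCMField.ringOfIntegersComplexConj K a)).hom.hom.hom (AlgPoints.map f.hom.hom.hom Q.1),
      map_mem_torsionPoints (ιB (IsCMField.ringOfIntegersComplexConj K a)) (map_mem_torsionPoints f Q.2)⟩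
    rfl (key _ Q.1).symm
  rw [e1, e2]
  exact hros a ⟨AlgPoints.map f.hom.hom.hom P.1, map_mem_torsionPoints f P.2⟩
    ⟨AlgPoints.map f.hom.hom.hom Q.1, map_mem_torsionPoints f Q.2⟩

end Pullback

/-! ## §3 The radical bound `Q^{ℓ^{#K(X)}} = 1` for `X` ample over an algebraically closed field -/

section Radical

variable {L : Type u} [Field L] [IsAlgClosed L] (A : AbelianVariety L)

/-- **The radical of `ē_{ℓᵏ}^X` in the second variable is killed by `ℓ^{#K(X)}`** for `X` ample and `ℓ` a prime
invertible in the algebraically closed ground field `L`: if `ē_{ℓᵏ}^X(P, Q) = 1` for every `P ∈ A[ℓᵏ](L)` then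
`t_Q^* X ∼ X`, i.e. `Q ∈ K(X)` (Lang VII §2 Prop. 4 — the tree's
`weilDiv_linEquiv_zero_of_forall_weilPairingLevel_eq_one`; its Kummer-theory hypotheses hold: `[ℓᵏ]` is an isogeny
(`isIsogeny_zsmul_id_holds`), flat (`IsIsogeny.flat_toSchemeHom_holds`), with `#A[ℓᵏ](L) = ℓ^{2gk} = deg [ℓᵏ]`
(`natCard_torsionPoints_eq_of_isAlgClosed`, `kerRank_zsmul_id_holds`)), and `K(X)` is a finite group for `X`
ample (Mumford §6 App. 1, `finite_KTheta`), so the `ℓ`-power torsion point `Q` satisfies `Q^{ℓ^{#K(X)}} = 1`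
(`pow_prime_pow_natCard_KTheta_eq_one`).  The exponent `c = #K(X)` is uniform in `k` — the shape `hrad` of
`mul_complexConj_eq_one_of_weilPairingLevel_eq`. [cite: Lang1983AbelianVarieties, Ch. VII §2 Prop. 4]
[cite: MumfordAV1970, §6 Application 1 (p. 60), §20 (pp. 183–186)] -/
theorem weilPairingLevel_radical_pow_card_KTheta {X : CartierDivisor A.X.left} (hX : X.IsAmple)
    {ℓ : ℕ} (hℓ : ℓ.Prime) (hℓL : (ℓ : L) ≠ 0) (k : ℕ)
    [IsDominant (Hom.toSchemeHom (((ℓ ^ k : ℕ) : ℤ) • 𝟙 A))]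
    (Q : A.torsionPoints L ((ℓ ^ k : ℕ) : ℤ))
    (h : ∀ P : A.torsionPoints L ((ℓ ^ k : ℕ) : ℤ), A.weilPairingLevel X P Q = 1) :
    (Q : A.Points L) ^ (ℓ ^ Nat.card (A.KTheta X)) = 1 := by
  have hN0 : (ℓ ^ k : ℕ) ≠ 0 := pow_ne_zero k hℓ.ne_zero
  have hNZ : ((ℓ ^ k : ℕ) : ℤ) ≠ 0 := Int.natCast_ne_zero.mpr hN0
  have hNL : (((ℓ ^ k : ℕ) : ℤ) : L) ≠ 0 := by
    rw [Int.cast_natCast, Nat.cast_pow]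
    exact pow_ne_zero k hℓL
  -- the Kummer-theory hypotheses on `[ℓ^k]_A`
  have hiso : IsIsogeny (((ℓ ^ k : ℕ) : ℤ) • 𝟙 A) := isIsogeny_zsmul_id_holds A _ hNZ
  haveI : Surjective (Hom.toSchemeHom (((ℓ ^ k : ℕ) : ℤ) • 𝟙 A)) := hiso.1
  haveI : IsFinite (Hom.toSchemeHom (((ℓ ^ k : ℕ) : ℤ) • 𝟙 A)) := hiso.2
  haveI : Flat (Hom.toSchemeHom (((ℓ ^ k : ℕ) : ℤ) • 𝟙 A)) := IsIsogeny.flat_toSchemeHom_holds hiso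
  have hcard : Nat.card (A.torsionPoints L ((ℓ ^ k : ℕ) : ℤ)) =
      (((ℓ ^ k : ℕ)) : ℤ).natAbs ^ (2 * A.dim) :=
    natCard_torsionPoints_eq_of_isAlgClosed A L _ hNL
  haveI : Finite (A.torsionPoints L ((ℓ ^ k : ℕ) : ℤ)) :=
    Nat.finite_of_card_ne_zero (by
      rw [hcard, Int.natAbs_natCast]
      exact pow_ne_zero _ hN0)
  have hdeg : Module.finrank A.X.left.functionField
      (FunctionFieldOver (Hom.toSchemeHom (((ℓ ^ k : ℕ) : ℤ) • 𝟙 A))) =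
        Nat.card (A.torsionPoints L ((ℓ ^ k : ℕ) : ℤ)) := by
    rw [← hiso.kerRank_eq_finrank_functionFieldOver, kerRank_zsmul_id_holds A _ hNZ, hcard]
  -- Lang VII §2 Prop. 4: `Q ∈ K(X)`; then `K(X)` finite
  have hKT : (Q : A.Points L) ∈ A.KTheta X :=
    (A.mem_KTheta_iff X _).2
      (weilDiv_linEquiv_zero_of_forall_weilPairingLevel_eq_one (Nat.pos_of_ne_zero hN0) hdeg X Q h)
  have hQk : (Q : A.Points L) ^ ℓ ^ k = 1 := by
    have hQ := (mem_torsionPoints_iff _ _).1 Q.2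
    rwa [zpow_natCast] at hQ
  exact A.pow_prime_pow_natCard_KTheta_eq_one hX hℓ hQk hKT

end Radical

end AbelianVariety

end Literature.AlgebraicGeometry.Motives

end
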